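import Mathlib
import Literature.Geometry.Lorentzian.KerrSchild
import Literature.Geometry.Lorentzian.BoundedGeometry

/-!
# Route PhotonSphereChannels · crux `TameCensorship` (stmt-FinalStateConjecture-17431) · line `Sketch`, skeleton v5 ·
# stub `stub_nullLegLowerBound`: under the `C⁰ ≤ ½` pin a null chart vector is quantitatively transverse to chart time

Helper file (`--supports stmt-FinalStateConjecture-17431`) of line `Sketch` (lead c2, 2026-08-17), brick P3a of the
PANCAKE LAW (alternative route to clause (a) of K3, skeleton v5). Clause (ii) of K3 pins the chart metric
`G = Ψ^* g` of a tame chart to the Minkowski form: `‖G − η‖ ≤ ½` in the operator norm of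
`E4 →L[ℝ] E4 →L[ℝ] ℝ` (`E4 = EuclideanSpace ℝ (Fin 4)`, `η = Minkowski.bilin`). This file proves the quantitative
transversality of null vectors to the chart time axis `∂₀ = E4.basisVector 0` under that pin:
`‖ℓ‖ ≤ 5 |G(ℓ, ∂₀)|` whenever `G(ℓ, ℓ) = 0` — the lower bound that lets the conjugate null leg
`n = −∂₀ / G(ℓ, ∂₀) + …` of the adapted frame have chart norm `O(1/‖ℓ‖)`. Pure linear algebra on `E4`.

References: B. O'Neill, *Semi-Riemannian Geometry* (1983), Ch. 5, Lemma 5.26 ff. (causal character in a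
Lorentz vector space).
-/

set_option linter.dupNamespace false

open Literature.Geometry.Lorentzian

noncomputable section

namespace Summit.FinalStateConjecture.FinalStateConjecture.Theorems.PhotonSphereChannels.TameCensorshipUnwind

/-- Pointwise form of the operator-norm pin: `|G(v, w) − η(v, w)| ≤ ‖G − η‖ ‖v‖ ‖w‖ ≤ ½ ‖v‖ ‖w‖`
(`ContinuousLinearMap.le_opNorm₂`). [folklore] -/
private theorem abs_sub_bilin_le {G : E4 →L[ℝ] E4 →L[ℝ] ℝ} (hpin : ‖G - Minkowski.bilin‖ ≤ 1 / 2)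
    (v w : E4) : |G v w - Minkowski.bilin v w| ≤ 1 / 2 * ‖v‖ * ‖w‖ := by
  have h1 := (G - Minkowski.bilin).le_opNorm₂ v w
  rw [sub_apply, sub_apply, Real.norm_eq_abs] at h1
  exact h1.trans (by gcongr)

/-- Pythagoras for the time/space splitting of the Euclidean norm on `E4`:
`‖v‖² = (v⁰)² + ∑ᵢ (vⁱ)²`. [folklore] -/
private theorem norm_sq_split (v : E4) : ‖v‖ ^ 2 = v 0 ^ 2 + ∑ i : Fin 3, v i.succ ^ 2 := by
  rw [EuclideanSpace.real_norm_sq_eq, Fin.sum_univ_succ]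

/-- `η(v, v) = ‖v‖² − 2 (v⁰)²` on `E4` (O'Neill 1983, Ch. 5, Ex. 5.1). [folklore] -/
private theorem bilin_self_eq (v : E4) : Minkowski.bilin v v = ‖v‖ ^ 2 - 2 * v 0 ^ 2 := by
  rw [Minkowski.bilin_apply, norm_sq_split]
  simp only [pow_two]
  ring

/-- The scalar inequality behind `stub_nullLegLowerBound`. With `g = G(∂₀, ∂₀) ≤ −½`,
`β = G(∂₀, ℓₛ)`, `|β| ≤ s/2` (`s = ‖ℓₛ‖`), `q = G(ℓₛ, ℓₛ) ≥ s²/2` and the expanded nullity relation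
`t (t g + β) + (t β + q) = 0` (`t = ℓ⁰`), one has `t² + s² ≤ (5 |t g + β|)²`: indeed
`(−g) q = a² − β²` for `a = t g + β`, so `q ≤ 2a²`, `s² ≤ 4a²`, and `t²/4 ≤ t² g² = (a − β)² ≤ 2a² + 2β² ≤ 4a²`.
[folklore] -/
private theorem null_scalar_bound {g β q s t : ℝ} (hg : g ≤ -1 / 2) (hβ : |β| ≤ 1 / 2 * s)
    (hq : s ^ 2 / 2 ≤ q) (hnull : t * (t * g + β) + (t * β + q) = 0) :
    t ^ 2 + s ^ 2 ≤ (5 * |t * g + β|) ^ 2 := by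
  have hq0 : 0 ≤ q := le_trans (by positivity) hq
  have hgq : g * q = β ^ 2 - (t * g + β) ^ 2 := by linear_combination g * hnull
  have hμ : (0 : ℝ) ≤ -g - 1 / 2 := by linarith
  have hq2 : q ≤ 2 * (t * g + β) ^ 2 - 2 * β ^ 2 := by nlinarith [mul_nonneg hμ hq0]
  have hβ2 : β ^ 2 ≤ s ^ 2 / 4 := by
    have h1 := abs_le.1 hβ
    nlinarith [h1.1, h1.2]
  have hs2 : s ^ 2 ≤ 4 * (t * g + β) ^ 2 := by nlinarith [sq_nonneg β]
  have hg2 : 1 / 4 ≤ g ^ 2 := by nlinarith [mul_nonneg hμ hμ]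
  have ht2 : t ^ 2 ≤ 16 * (t * g + β) ^ 2 := by
    have h1 : (t * g) ^ 2 ≤ 2 * (t * g + β) ^ 2 + 2 * β ^ 2 := by
      nlinarith [sq_nonneg (t * g + 2 * β)]
    have h2 : t ^ 2 * (1 / 4) ≤ t ^ 2 * g ^ 2 := mul_le_mul_of_nonneg_left hg2 (sq_nonneg t)
    nlinarith [h1, h2, hβ2, hs2]
  rw [mul_pow, sq_abs]
  linarith [sq_nonneg (t * g + β)]

/-- **Stub `stub_nullLegLowerBound` of line `Sketch` (skeleton v5) for the crux `PhotonSphereChannels.TameCensorship`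
(stmt-FinalStateConjecture-17431).** For a symmetric bilinear form `G` on `E4` with `‖G − η‖ ≤ ½`, every `G`-null
vector `ℓ` satisfies `‖ℓ‖ ≤ 5 |G(ℓ, ∂₀)|`. Proof: write `ℓ = ℓ⁰ ∂₀ + ℓₛ` with `ℓₛ⁰ = 0`, `h := G − η`,
`μ := −G(∂₀, ∂₀) = 1 − h(∂₀, ∂₀) ∈ [½, 3⁄2]`, `β := G(∂₀, ℓₛ) = h(∂₀, ℓₛ)`, `|β| ≤ ‖ℓₛ‖/2`,
`a := G(ℓ, ∂₀) = β − μ ℓ⁰`. Nullity: `0 = −μ (ℓ⁰)² + 2 ℓ⁰ β + G(ℓₛ, ℓₛ)`, so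
`‖ℓₛ‖²/2 ≤ G(ℓₛ, ℓₛ) = (a² − β²)/μ ≤ 2 a²`; hence `‖ℓₛ‖ ≤ 2|a|`, `|ℓ⁰| = |β − a|/μ ≤ 2(|β| + |a|) ≤ 4|a|`, and
`‖ℓ‖² = (ℓ⁰)² + ‖ℓₛ‖² ≤ 20 a² ≤ 25 a²` (the scalar bookkeeping is `null_scalar_bound`).
[folklore; O'Neill 1983, Ch. 5] -/
theorem stub_nullLegLowerBound :
    ∀ (G : E4 →L[ℝ] E4 →L[ℝ] ℝ), (∀ v w : E4, G v w = G w v) → ‖G - Minkowski.bilin‖ ≤ 1 / 2 →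
    ∀ ℓ : E4, G ℓ ℓ = 0 → ‖ℓ‖ ≤ 5 * |G ℓ (E4.basisVector 0)| := by
  intro G hG hpin ℓ hℓ
  have hb := abs_sub_bilin_le hpin
  set e₀ : E4 := E4.basisVector 0 with he₀
  -- the time axis `e₀ = ∂₀`
  have he₀n : ‖e₀‖ = 1 := by simp [he₀]
  have he₀0 : e₀ 0 = 1 := by simp [he₀]
  -- time/space splitting `ℓ = t ∂₀ + ℓₛ`
  obtain ⟨t, ht⟩ : ∃ t : ℝ, t = ℓ 0 := ⟨_, rfl⟩
  obtain ⟨ℓs, hℓs⟩ : ∃ v : E4, v = ℓ - t • e₀ := ⟨_, rfl⟩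
  have hℓs0 : ℓs 0 = 0 := by simp [hℓs, he₀0, ht]
  have hℓsi : ∀ i : Fin 3, ℓs i.succ = ℓ i.succ := by
    intro i
    simp [hℓs, he₀, Fin.succ_ne_zero]
  have hdec : ℓ = t • e₀ + ℓs := by rw [hℓs]; abel
  have hnorm : ‖ℓ‖ ^ 2 = t ^ 2 + ‖ℓs‖ ^ 2 := by
    rw [norm_sq_split ℓ, norm_sq_split ℓs, hℓs0, ht]
    simp only [hℓsi]
    ring
  -- Minkowski values on the splitting
  have hη00 : Minkowski.bilin e₀ e₀ = -1 := by rw [he₀]; exact Minkowski.bilin_basisVector_zero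
  have hη0s : Minkowski.bilin e₀ ℓs = 0 := by
    rw [he₀, Minkowski.bilin_basisVector_zero_left, hℓs0, neg_zero]
  have hηss : Minkowski.bilin ℓs ℓs = ‖ℓs‖ ^ 2 := by
    rw [bilin_self_eq, hℓs0]
    ring
  -- the pin, evaluated on the splitting
  have hg : G e₀ e₀ ≤ -1 / 2 := by
    have h1 := hb e₀ e₀
    rw [hη00, he₀n, mul_one, mul_one, sub_neg_eq_add] at h1
    linarith [(abs_le.1 h1).2]
  have hβ : |G e₀ ℓs| ≤ 1 / 2 * ‖ℓs‖ := by
    have h1 := hb e₀ ℓs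
    rwa [hη0s, sub_zero, he₀n, mul_one] at h1
  have hq : ‖ℓs‖ ^ 2 / 2 ≤ G ℓs ℓs := by
    have h1 := hb ℓs ℓs
    rw [hηss] at h1
    linarith [(abs_le.1 h1).1]
  -- bilinear expansions of `a = G(ℓ, ∂₀)` and of the nullity `G(ℓ, ℓ) = 0`
  have ha : G ℓ e₀ = t * G e₀ e₀ + G e₀ ℓs := by
    rw [hdec, map_add, map_smul, add_apply, smul_apply, smul_eq_mul, hG ℓs e₀]
  have hnull : t * (t * G e₀ e₀ + G e₀ ℓs) + (t * G e₀ ℓs + G ℓs ℓs) = 0 := by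
    have h1 := hℓ
    rw [hdec] at h1
    simpa only [map_add, map_smul, add_apply, smul_apply, smul_eq_mul, hG ℓs e₀] using h1
  -- scalar bookkeeping
  have key := null_scalar_bound hg hβ hq hnull
  rw [← hnorm] at key
  rw [ha]
  exact le_of_sq_le_sq key (by positivity)

end Summit.FinalStateConjecture.FinalStateConjecture.Theorems.PhotonSphereChannels.TameCensorshipUnwind

end
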